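import Summits.CriticalPhenomena.CardyFormulaZ2.Theorems.CardyComplexConeEdgePrecompactUFRSJunctionGate
import Literature.Probability.Percolation.BlockExplorationBasic
import Literature.Probability.Percolation.ZdFourArmOutLandedBarrier

/-!
# The junction gate from an exploration: the deterministic extraction of the blocking arch
(line `qkz-strip-boundary-arm` of crux `CardyComplexCone.EdgePrecompact`, stmt-CriticalPhenomena-11387;
first file of the registered sub-goal S1 = `ufrs_junctionGate_prob` of the per-scale junction bound
HJ-S, lead c5 wave 3; registered anchor `ufrsGateWith_of_exploration`)

The gate `ufrsGateWith RA FA RB FB` (`…UFRSJunctionGate.lean`) asks for an open simple path `P`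
and a closed dual simple path `Q` MEETING at a corner `(v₀, f₀)`. Such a meeting point cannot be
pinned in advance (that would cost a mixed two-arm event); it is produced by the exploration of
Basu–Sapozhnikov (`explSet`, `BlockExploration*.lean`): with `U = explSet FA RA ω` the set of sites
of `RA` joined to the foot `FA` by `ω`-open paths inside `RA`,

* `ufrsGateWith_of_exploration` (registered anchor): if `U` contains an open left-right crossing
  `W` of a box `[L, R] × [B, T]`, and there is a walk of faces `W'` inside `RB` (whose faces span
  abscissae in `[L, R]` and ordinates `≤ T`) from the face row `T` down to a face of `FB` (below the
  row `B`), each of whose separating edges is `ω`-closed OR touches `U` — this is what a dual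
  crossing of the configuration deprived of the edges touching `U` provides — then
  `ω ∈ ufrsGateWith RA FA RB FB`. Proof: the initial piece of `W'` down to the face row `B - 1`
  crosses an edge of `W` (`exists_dart_sepEdge_mem_edges_at`, the planar crossing lemma of
  `PlanarDuality.lean` translated to a general box), so some separating edge of `W'` touches `U`;
  following `W'` backwards from its foot, the first separating edge touching `U` gives the face
  `f₀` (before crossing it) and the corner `v₀ ∈ U` (an endpoint of it, `isCorner_of_mem_sepEdge`);
  `Q` is the piece of `W'` between the foot and `f₀` made simple (`Walk.bypass`; its separating
  edges touch no site of `U`, hence are `ω`-closed), and `P` is an open path from `v₀` to `FA`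
  inside `U` (`openConnIn_explSet_of_mem_explSet`) made simple; since `P ⊆ U`, `Q` crosses no
  edge touching `P`.
* Walk surgery used on the way: `exists_prefix_to_row` (cut a lattice walk at its first visit of a
  row, discrete intermediate values), `exists_prefix_first_dart` (cut a walk before its first dart
  with a given property).

References: D. Basu, A. Sapozhnikov, Electron. Commun. Probab. 22 (2017), §2 (exploration from
inside); H. Kesten, Comm. Math. Phys. 109 (1987), §2; B. Bollobás, O. Riordan, *Percolation*
(2006), Ch. 3, Lemma 1 (a horizontal crossing separates top from bottom faces).
-/

namespace Summit.CriticalPhenomena.CardyFormulaZ2.Cruxes.EdgePrecompact.QkzStripBoundaryArm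

open MeasureTheory Filter Set Metric
open scoped Topology BigOperators Pointwise
open Literature.Probability.LatticeModels Literature.Probability.Percolation
open Literature.Probability.RandomPlanarGeometry (DobrushinDomain)
open Summit.CriticalPhenomena.CardyFormulaZ2.Theses.CardyComplexCone

noncomputable section

open SimpleGraph

/-! ## Walk surgery -/

/-- **Cut a lattice walk at its first visit of a row.** A walk of `ℤ²` starting at ordinate `≥ B`
and ending at ordinate `< B` has an initial piece ending on the row `B - 1` all of whose vertices
have ordinate `≥ B - 1` (ordinates change by at most one along a lattice step). -/
theorem exists_prefix_to_row_HJ {u v : Site 2} (p : (zdGraph 2).Walk u v) {B : ℤ} (hu : B ≤ u 1) (hv : v 1 < B) :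
    ∃ (w : Site 2) (q : (zdGraph 2).Walk u w) (rest : (zdGraph 2).Walk w v), p = q.append rest ∧ w 1 = B - 1 ∧
      ∀ z ∈ q.support, B - 1 ≤ z 1 := by
  induction p with
  | nil => exact absurd hu (not_le.2 hv)
  | @cons x y z hxy p ih =>
    by_cases hy : B ≤ y 1
    · obtain ⟨w, q, rest, hp, hw, hq⟩ := ih hy hv
      refine ⟨w, Walk.cons hxy q, rest, by rw [hp]; rfl, hw, fun a ha => ?_⟩
      rw [Walk.support_cons, List.mem_cons] at ha
      rcases ha with rfl | ha
      · omega
      · exact hq a ha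
    · have hy' : y 1 = B - 1 := by
        rcases stepKind_of_adj hxy with ⟨-, h1⟩ | ⟨-, h1⟩ | ⟨h1, -⟩ | ⟨h1, -⟩ <;> omega
      refine ⟨y, Walk.cons hxy Walk.nil, p, rfl, hy', fun a ha => ?_⟩
      rw [Walk.support_cons, Walk.support_nil, List.mem_cons, List.mem_singleton] at ha
      rcases ha with rfl | rfl <;> omega

/-- **Cut a walk before its first dart with a given property.** If some dart of `p` satisfies `Pd`,
then `p = q ++ (d :: rest)` where `d` satisfies `Pd` and no dart of `q` does. -/
theorem exists_prefix_first_dart_HJ {V : Type*} {G : SimpleGraph V} {u v : V} (p : G.Walk u v) (Pd : G.Dart → Prop)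
    (h : ∃ d ∈ p.darts, Pd d) :
    ∃ (w w' : V) (q : G.Walk u w) (hw : G.Adj w w') (rest : G.Walk w' v),
      p = q.append (Walk.cons hw rest) ∧ Pd ⟨(w, w'), hw⟩ ∧ ∀ d ∈ q.darts, ¬ Pd d := by
  classical
  induction p with
  | nil => obtain ⟨d, hd, -⟩ := h; simp at hd
  | @cons x y z hxy p ih =>
    by_cases hfirst : Pd ⟨(x, y), hxy⟩
    · exact ⟨x, y, Walk.nil, hxy, p, rfl, hfirst, fun d hd => by simp at hd⟩
    · have h' : ∃ d ∈ p.darts, Pd d := by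
        obtain ⟨d, hd, hPd⟩ := h
        rw [Walk.darts_cons, List.mem_cons] at hd
        rcases hd with rfl | hd
        · exact absurd hPd hfirst
        · exact ⟨d, hd, hPd⟩
      obtain ⟨w, w', q, hw, rest, hp, hPd, hq⟩ := ih h'
      refine ⟨w, w', Walk.cons hxy q, hw, rest, by rw [hp]; rfl, hPd, fun d hd => ?_⟩
      rw [Walk.darts_cons, List.mem_cons] at hd
      rcases hd with rfl | hd
      · exact hfirst
      · exact hq d hd

/-- Darts of a reversed walk are the reversed darts: this is Mathlib's
`SimpleGraph.Walk.mem_darts_reverse` (deprecated duplicate kept as an alias, dedup-03036). -/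
@[deprecated SimpleGraph.Walk.mem_darts_reverse (since := "2026-08-17")]
alias mem_darts_reverse_iff_HJ := SimpleGraph.Walk.mem_darts_reverse

/-! ## Corners of the separating edge -/

/-- **Both endpoints of the edge separating two adjacent faces are corners of the first face**
(and, by `sepEdge_comm`, of the second). -/
theorem isCorner_of_mem_sepEdge_HJ {g g' x : Site 2} (h : (zdGraph 2).Adj g g') (hx : x ∈ sepEdge g g') :
    Literature.Probability.LatticeModels.IsCorner x g := by
  intro i
  rcases stepKind_of_adj h with ⟨h0, h1⟩ | ⟨h0, h1⟩ | ⟨h1, h0⟩ | ⟨h1, h0⟩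
  · obtain rfl : g' = g + Pi.single 0 1 := by simp [Site.eq_iff_two, h0, h1]
    rw [sepEdge_right, Sym2.mem_iff] at hx
    fin_cases i <;> rcases hx with rfl | rfl <;> simp
  · obtain rfl : g = g' + Pi.single 0 1 := by simp [Site.eq_iff_two, h0, h1]
    rw [sepEdge_comm, sepEdge_right, Sym2.mem_iff] at hx
    fin_cases i <;> rcases hx with rfl | rfl <;> simp
  · obtain rfl : g' = g + Pi.single 1 1 := by simp [Site.eq_iff_two, h0, h1]
    rw [sepEdge_up, Sym2.mem_iff] at hx
    fin_cases i <;> rcases hx with rfl | rfl <;> simp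
  · obtain rfl : g = g' + Pi.single 1 1 := by simp [Site.eq_iff_two, h0, h1]
    rw [sepEdge_comm, sepEdge_up, Sym2.mem_iff] at hx
    fin_cases i <;> rcases hx with rfl | rfl <;> simp

/-- The endpoints of a separating edge which is an edge of a walk are vertices of the walk:
the case `e = sepEdge g g'` of `Literature.Probability.Percolation.mem_support_of_mem_edges`
(deprecated duplicate kept as an alias, dedup-03037). -/
@[deprecated Literature.Probability.Percolation.mem_support_of_mem_edges (since := "2026-08-17")]
alias mem_support_of_mem_sepEdge_of_mem_edges_HJ :=
  Literature.Probability.Percolation.mem_support_of_mem_edges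

/-! ## The planar crossing lemma in a general box -/

/-- **A left-right crossing separates the top faces from the bottom faces** in the box
`[L, R] × [B, T]`: this is
`Literature.Probability.Percolation.exists_dart_sepEdge_mem_edges_lr_box`
(`ZdFourArmOutLandedBarrier.lean`, same statement; deprecated duplicate kept as an alias). -/
@[deprecated Literature.Probability.Percolation.exists_dart_sepEdge_mem_edges_lr_box
  (since := "2026-08-17")]
alias exists_dart_sepEdge_mem_edges_at_HJ :=
  Literature.Probability.Percolation.exists_dart_sepEdge_mem_edges_lr_box

/-! ## The extraction -/

/-- **The gate from an exploration** (registered anchor `ufrsGateWith_of_exploration` of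
stmt-CriticalPhenomena-11387). Let `U = explSet FA RA ω` (`FA ⊆ RA`, `ω` a lattice configuration).
If `U` contains a lattice walk `W` crossing the box `[L, R] × [B, T]` from the column `L` to the
column `R`, and `W'` is a walk of faces inside `RB` — all faces of `RB` having abscissae in
`[L, R - 1]` and ordinates `≤ T`, all faces of `FB` ordinates `< B` — from a face of the row `T` to
a face of `FB`, each of whose separating edges is `ω`-closed or has an endpoint in `U`, then
`ω ∈ ufrsGateWith RA FA RB FB`. See the module docstring for the proof. -/
theorem ufrsGateWith_of_exploration : ∀ (RA FA RB FB : Set (Site 2)) (ω : BondConfig (Site 2)) (L R B T : ℤ) (a b t s : Site 2) (W : (zdGraph 2).Walk a b) (W' : (zdGraph 2).Walk t s), ω ⊆ (zdGraph 2).edgeSet → FA ⊆ RA → (∀ z ∈ RB, L ≤ z 0 ∧ z 0 + 1 ≤ R ∧ z 1 ≤ T) → (∀ z ∈ FB, z 1 < B) → a 0 = L → b 0 = R → (∀ z ∈ W.support, L ≤ z 0 ∧ z 0 ≤ R ∧ B ≤ z 1 ∧ z 1 ≤ T) → (∀ z ∈ W.support, z ∈ explSet FA RA ω) → t 1 = T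 → s ∈ FB → (∀ z ∈ W'.support, z ∈ RB) → (∀ d ∈ W'.darts, sepEdge d.fst d.snd ∉ ω ∨ ∃ x ∈ sepEdge d.fst d.snd, x ∈ explSet FA RA ω) → ω ∈ ufrsGateWith RA FA RB FB := by
  intro RA FA RB FB ω L R B T a b t s W W' hω hFA hRB hFB ha hb hWbox hWU ht hs hW'RB hW'closed
  classical
  set U := explSet FA RA ω with hU
  -- Step 1: the initial piece of `W'` down to the row `B - 1` crosses an edge of `W`
  have hsB : s 1 < B := hFB s hs
  have htB : B ≤ t 1 := by
    rw [ht]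
    have h1 := hWbox a (Walk.start_mem_support W)
    exact h1.2.2.1.trans h1.2.2.2
  obtain ⟨w₁, q₁, rest₁, hW'eq, hw₁, hq₁⟩ := exists_prefix_to_row_HJ W' htB hsB
  have hq₁supp : ∀ z ∈ q₁.support, z ∈ W'.support := fun z hz => by
    rw [hW'eq, Walk.support_append]; exact List.mem_append_left _ hz
  have hq₁box : ∀ z ∈ q₁.support, L ≤ z 0 ∧ z 0 + 1 ≤ R ∧ B - 1 ≤ z 1 ∧ z 1 ≤ T := fun z hz => by
    have h1 := hRB z (hW'RB z (hq₁supp z hz))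
    exact ⟨h1.1, h1.2.1, hq₁ z hz, h1.2.2⟩
  obtain ⟨dq, hdq, hdqW⟩ :=
    Literature.Probability.Percolation.exists_dart_sepEdge_mem_edges_lr_box W q₁ hWbox hq₁box
      ha hb ht hw₁
  -- hence some separating edge of `W'` touches `U`
  have htouch : ∃ d ∈ W'.reverse.darts, ∃ x ∈ sepEdge d.fst d.snd, x ∈ U := by
    refine ⟨dq.symm, (Walk.mem_darts_reverse (d := dq.symm) (p := W')).2 ?_, sepLo dq.fst dq.snd,
      ?_, ?_⟩
    · rw [Dart.symm_symm, hW'eq, Walk.darts_append]; exact List.mem_append_left _ hdq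
    · show sepLo dq.fst dq.snd ∈ sepEdge dq.snd dq.fst
      rw [sepEdge_comm]; exact Sym2.mem_mk_left _ _
    · exact hWU _ (Literature.Probability.Percolation.mem_support_of_mem_edges _ hdqW
        (Sym2.mem_mk_left _ _))
  -- Step 2: the first such edge seen from the foot `s`
  obtain ⟨f₀, f₁, q, hf, rest, hrev, ⟨v₀, hv₀e, hv₀U⟩, hqno⟩ :=
    exists_prefix_first_dart_HJ W'.reverse (fun d => ∃ x ∈ sepEdge d.fst d.snd, x ∈ U) htouch
  -- darts of `q` are reversed darts of `W'`
  have hqW' : ∀ d ∈ q.darts, d.symm ∈ W'.darts := fun d hd => by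
    have h1 : d ∈ W'.reverse.darts := by rw [hrev, Walk.darts_append]; exact List.mem_append_left _ hd
    exact (Walk.mem_darts_reverse (d := d) (p := W')).1 h1
  have hqsupp : ∀ z ∈ q.support, z ∈ W'.support := fun z hz => by
    have h1 : z ∈ W'.reverse.support := by rw [hrev, Walk.support_append]; exact List.mem_append_left _ hz
    rwa [Walk.support_reverse, List.mem_reverse] at h1
  -- Step 3: the dual path `Q` from `f₀` back to the foot
  set Q : (zdGraph 2).Walk f₀ s := q.reverse.bypass with hQ
  have hQpath : Q.IsPath := Walk.bypass_isPath _
  have hQdarts : ∀ d ∈ Q.darts, d ∈ q.reverse.darts := fun d hd => Walk.darts_bypass_subset_darts _ hd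
  have hQsupp : ∀ z ∈ Q.support, z ∈ RB := fun z hz => by
    have h1 := Walk.support_bypass_subset_support _ hz
    rw [Walk.support_reverse, List.mem_reverse] at h1
    exact hW'RB z (hqsupp z h1)
  have hQno : ∀ d ∈ Q.darts, ∀ x ∈ sepEdge d.fst d.snd, x ∉ U := by
    intro d hd x hx hxU
    have h1 : d.symm ∈ q.darts := (Walk.mem_darts_reverse (d := d) (p := q)).1 (hQdarts d hd)
    refine hqno d.symm h1 ⟨x, ?_, hxU⟩
    show x ∈ sepEdge d.snd d.fst
    rwa [sepEdge_comm]
  have hQclosed : ∀ d ∈ Q.darts, sepEdge d.fst d.snd ∉ ω := by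
    intro d hd he
    have h1 : d.symm ∈ q.darts := (Walk.mem_darts_reverse (d := d) (p := q)).1 (hQdarts d hd)
    have h2 : d.symm.symm ∈ W'.darts := hqW' _ h1
    rw [Dart.symm_symm] at h2
    rcases hW'closed d h2 with h3 | ⟨x, hx, hxU⟩
    · exact h3 he
    · exact hQno d hd x hx hxU
  -- Step 4: the corner `v₀ ∈ U` of `f₀` and the open path `P` from `v₀` to the foot `FA` inside `U`
  have hcorner : Literature.Probability.LatticeModels.IsCorner v₀ f₀ := isCorner_of_mem_sepEdge_HJ hf hv₀e
  have hUsub : U ⊆ RA := fun z hz => by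
    rcases explSet_subset FA RA ω hz with h1 | h1
    · exact hFA h1
    · exact h1
  obtain ⟨u, huFA, P, hPpath, hPsupp, hPedges⟩ : ∃ u ∈ FA, ∃ P : (zdGraph 2).Walk v₀ u, P.IsPath ∧
      (∀ z ∈ P.support, z ∈ U) ∧ ∀ e ∈ P.edges, e ∈ ω := by
    obtain ⟨-, u, hu, hconn⟩ := mem_explSet_iff_exists.1 hv₀U
    have hconnU : ω ∈ openConnIn U u v₀ := openConnIn_explSet_of_mem_explSet (subset_explSet FA RA ω hu) hconn
    obtain ⟨T₀, hT₀s, hT₀e⟩ := exists_walk_of_mem_openConnIn hω hconnU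
    refine ⟨u, hu, T₀.reverse.bypass, Walk.bypass_isPath _, fun z hz => ?_, fun e he => ?_⟩
    · have h1 := Walk.support_bypass_subset_support _ hz
      rw [Walk.support_reverse, List.mem_reverse] at h1
      exact hT₀s z h1
    · have h1 := Walk.edges_bypass_subset_edges _ he
      rw [Walk.edges_reverse, List.mem_reverse] at h1
      exact hT₀e e h1
  -- Step 5: assemble
  refine ⟨v₀, u, f₀, s, P, Q, hcorner, hPpath, hQpath, fun z hz => hUsub (hPsupp z hz), huFA, hPedges, hQsupp, hs,
    hQclosed, fun d hd x hx hxP => hQno d hd x hx (hPsupp x hxP)⟩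

end

end Summit.CriticalPhenomena.CardyFormulaZ2.Cruxes.EdgePrecompact.QkzStripBoundaryArm
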